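import Summits.BirchSwinnertonDyer.BirchSwinnertonDyer.Theorems.SignedLowerHalvesSmallImageLowerHalfBothSignsRttD2SeqJ3HLayerPT
import Summits.BirchSwinnertonDyer.BirchSwinnertonDyer.Theorems.SignedLowerHalvesSmallImageLowerHalfBothSignsRttD2SeqJ3HDescent
import Summits.BirchSwinnertonDyer.BirchSwinnertonDyer.Theorems.SignedLowerHalvesSmallImageLowerHalfBothSignsRttD2SeqJ3HStrict
import Summits.BirchSwinnertonDyer.BirchSwinnertonDyer.Theorems.SignedLowerHalvesSmallImageLowerHalfBothSignsRttD2SeqJ3RSeq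
import Summits.BirchSwinnertonDyer.BirchSwinnertonDyer.Theorems.SignedLowerHalvesSmallImageLowerHalfBothSignsRttD2SeqJ3Good
import Summits.BirchSwinnertonDyer.BirchSwinnertonDyer.Theorems.SignedLowerHalvesSmallImageLowerHalfBothSignsRttD2SeqJ3Finite
import Literature.NumberTheory.ComplexMultiplication.EllipticUnits.ImaginaryQuadraticMainConjectureCarriersOLevels
import HarnessLib

/-!
# Route `SignedLowerHalves`, crux L `SmallImageLowerHalfBothSigns` (stmt-BirchSwinnertonDyer-23599), line `rtt_w3` v16 — E2, row J3 residual
# (`hsolL`), brick H7a: FINITE-LEVEL SOLVABILITY FROM LAYER ORTHOGONALITY — at every level `m`, a character `q` of the saturated local condition group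
# `E^ε_{sat,v}` that kills the layer localisations of the admissible global torsion-level classes landing in the good set is realised on
# `goodLevel m m` by the layer pairing against a class of g22's STRICT set `strictLevel S κ θ′ P S₀ m m`

WIDTH seat `bsd-line-slh-p3-w3` g23 under LEAD `cruxlead-stmt-BirchSwinnertonDyer-23599` g11 (cell `bsd-ssimc`); helper `--supports stmt-BirchSwinnertonDyer-23599`.
THEOREMS ONLY (no definition, no named fact, no instance, no `sorry`). HONEST FRAMING: assembly of H4 (Poitou–Tate solvability at a layer, Milne I 4.10 (b) for THE
canonical maps on `Maps(Γ_K ⧸ U_m, X_m)`), H1 (descent to `cycLayerCohO`), H6 (strict clauses) and R4 (`locNK = θ^* ∘ infl`) in g22's junction currency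
(`locPairNK`, `goodLevel`, `strictLevel`); the remaining input of `hsolL` is the LAYER ORTHOGONALITY hypothesis `horth` (brick H5: control in the local tower).
Hypotheses made explicit (LEAD's setting): `P = S₀ ∪ {v}` (`hvP`, `hS₀P`, `hPS₀`), `v ∉ S₀`, `p` lies under `v` only (`hpv`), `K_∞/K` unramified outside `P` (`hNP`),
`v` non-split in `K_∞` (`hv`), and perfectness of the level-`m` coefficient pairing (`hperf`). Nothing about any curve; E2, crux L, crux M, BSD remain OPEN and are
proved for NO curve.

* ★★★ `exists_mem_strictLevel_locPairNK_eq_of_orth` — `∃ y ∈ strictLevel S κ θ′ P S₀ m m, ∀ ℓ ∈ goodLevel m m, locPairNK … m m y ℓ = q ⟨ℓ⟩`, given `horth`.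
References: [MilneADT2006] I Thm. 4.10 (b); [NeukirchSchmidtWingberg2008] (8.6.2)–(8.6.3), I §6 (1.6.4); [Kobayashi2003] Thm. 7.3 i); [Rubin2000] Thm. 1.7.3; [PerrinRiou1987] §4.
-/

set_option autoImplicit false
set_option linter.dupNamespace false -- D-0017: single-problem summit, the namespace repeats the problem name by design
noncomputable section

open scoped Classical
open NumberField IsDedekindDomain Field CategoryTheory Function

namespace Summit.BirchSwinnertonDyer.BirchSwinnertonDyer.Theorems.SmallImageRttD2Seq

open Literature.NumberTheory.EllipticCurves Literature.NumberTheory.GaloisRepresentations Literature.NumberTheory.GaloisCohomology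
  Literature.NumberTheory.EllipticCurves.GreenbergVatsal2000 Literature.NumberTheory.ComplexMultiplication.EllipticUnits.JohnsonLeungKings2011
  Literature.NumberTheory.GaloisRepresentations.DiscreteGaloisModule
  Summit.BirchSwinnertonDyer.BirchSwinnertonDyer.Theorems.SmallImageCharSignedSelmer Summit.BirchSwinnertonDyer.BirchSwinnertonDyer.Theorems.SmallImageRttD2J1
open Literature.AnabelianGeometry.AbsoluteAnabelian.Prop121vii (zmodToQmodZ zmodToQmodZ_injective)

section Solve

variable {K : Type} [Field K] [NumberField K] {p : ℕ} [Fact p.Prime] (S : Set (PadicAlgCl p)) [FiniteDimensional ℚ_[p] (padicCoeffField S)] (κ : ZpExtension K p)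
  (θ' : absoluteGaloisGroup K →ₜ* (padicCoeffIntegers S)ˣ) (P : Set (HeightOneSpectrum (𝓞 K))) (v : HeightOneSpectrum (𝓞 K))
  (M : Type) [AddCommGroup M] [TopologicalSpace M] [DiscreteTopology M] [DistribMulAction (absoluteGaloisGroup K) M]
  [Module (padicCoeffIntegers S) M]
  (hstabK : ∀ m : M, IsOpen (MulAction.stabilizer (absoluteGaloisGroup K) m : Set (absoluteGaloisGroup K)))

omit [NumberField K] [FiniteDimensional ℚ_[p] (padicCoeffField S)] in
/-- Two continuous equivariant pairings with the same values are equal (the structure has one data field). [folklore] -/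
theorem contPairing_eq_of_toLin_eq {G : Type} [Group G] [TopologicalSpace G] {X Y Z : TopRep.{0} ℤ G} {P₁ P₂ : ContPairing X Y Z}
    (h : P₁.toLin = P₂.toLin) : P₁ = P₂ := by
  obtain ⟨f, _, _⟩ := P₁
  obtain ⟨g, _, _⟩ := P₂
  cases h
  rfl

omit [NumberField K] [FiniteDimensional ℚ_[p] (padicCoeffField S)] in
/-- **`X_k` is unramified outside `P`** as a `Γ_K`-module: the inertia groups off `P` lie in `N_P`, which acts trivially (the module is inflated from `G_P`).
[cite: NeukirchSchmidtWingberg2008, VIII §3] -/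
theorem isUnramifiedAt_coeffRepK (k : ℕ) {w : HeightOneSpectrum (𝓞 K)} (hw : w ∉ P) : GaloisRep.IsUnramifiedAt w (coeffRepK S θ' P k) := by
  intro 𝔓 h𝔓 σ hσ
  refine LinearMap.ext fun x ↦ ?_
  exact coeffRepK_ρ_apply_eq_self_of_mem S θ' P k (inertia_le_ramificationSubgroup hw h𝔓 hσ) x

omit [FiniteDimensional ℚ_[p] (padicCoeffField S)] in
/-- **Readout** (descent H1 + strictness H6 + `loc = θ^* ∘ infl` R4): a global class `y ∈ H¹(U_m, X_m)` whose Shapiro lift is locally trivial above `S₀`, which dies on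
the inertia groups off `P`, and whose layer pairing against the good classes is prescribed, yields a class of g22's strict set with the prescribed `locPairNK` values.
[cite: NeukirchSchmidtWingberg2008, (8.6.2)–(8.6.3), I §6 Prop. (1.6.4)] [cite: Kobayashi2003, Thm. 7.3 i)] -/
theorem exists_mem_strictLevel_locPairNK_eq_of_layer_class (V : WeierstrassCurve K) (j : V.geomPrimaryTorsion p →+ M) (S₀ : Set (HeightOneSpectrum (𝓞 K))) (ε : ℤˣ)
    (PG : ∀ k : ℕ, ContPairing (coeffRepK S θ' P k).toTopRep (torsRep M hstabK p k).toTopRep (mu K (p ^ k)).toTopRep)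
    (hNP : ∀ n, ramificationSubgroup K P ≤ κ.layerSubgroup n)
    [hF : ∀ n : ℕ, Fintype (absoluteGaloisGroup K ⧸ κ.layerSubgroup n)]
    [hR : ∀ n : ℕ, Fintype (↥(κ.layerSubgroup n) ⧸ (κ.layerSubgroup (n + 1)).subgroupOf (κ.layerSubgroup n))]
    (hstab : letI := localAction (closureEmb (K := K) (v.adicCompletion K)) M
      ∀ m : M, IsOpen (MulAction.stabilizer (absoluteGaloisGroup (v.adicCompletion K)) m : Set (absoluteGaloisGroup (v.adicCompletion K))))
    (q : letI := localAction (closureEmb (K := K) (v.adicCompletion K)) M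
      localCondInftySat κ M (padicCoeffIntegers S) V j ε v →+ AddCircle (1 : ℚ))
    (m : ℕ) {s : absoluteGaloisGroup K ⧸ κ.layerSubgroup m → absoluteGaloisGroup K} (hs : ∀ x, (s x : absoluteGaloisGroup K ⧸ κ.layerSubgroup m) = x)
    (hs1 : s ((1 : absoluteGaloisGroup K) : absoluteGaloisGroup K ⧸ κ.layerSubgroup m) = 1)
    (y : continuousCohomology 1 (subgroupRep (coeffRepK S θ' P m).toTopRep (κ.layerSubgroup m)))
    (hyS₀ : ∀ w ∈ S₀, ContinuousCohomology.map (resGalOfEmb (closureEmb (K := K) (w.adicCompletion K)))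
        (𝟙 (TopRep.res (resGalOfEmb (closureEmb (K := K) (w.adicCompletion K)) : absoluteGaloisGroup (w.adicCompletion K) →* absoluteGaloisGroup K)
          (coindFin.{0, 0} (coeffRepK S θ' P m).toTopRep (κ.layerSubgroup m)))) 1
        (shapiroLift (coeffRepK S θ' P m).toTopRep (κ.layerSubgroup m) (κ.isOpen_layerSubgroup m) hs hs1 y) = 0)
    (hyur : ∀ w : HeightOneSpectrum (𝓞 K), w ∉ P → ∀ 𝔓 ∈ w.primesAbove,
      resLe (coeffRepK S θ' P m).toTopRep (inf_le_left : κ.layerSubgroup m ⊓ 𝔓.inertia (absoluteGaloisGroup K) ≤ κ.layerSubgroup m) 1 y = 0)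
    (hyval : letI := localAction (closureEmb (K := K) (v.adicCompletion K)) M
      haveI : NeZero (p ^ m) := ⟨pow_ne_zero _ (Fact.out : p.Prime).ne_zero⟩
      haveI : IsClosed (localSubgroupOfEmb (κ.layerSubgroup m) (closureEmb (K := K) (v.adicCompletion K)) : Set (absoluteGaloisGroup (v.adicCompletion K))) :=
        isClosed_localLayer κ v m
      letI : Fintype (absoluteGaloisGroup (v.adicCompletion K) ⧸ localSubgroupOfEmb (κ.layerSubgroup m) (closureEmb (K := K) (v.adicCompletion K))) :=
        fintypeQuotLocalLayer κ v m
      ∀ (ℓ : subgroupH1 (localSubgroupOfEmb (κ.layerSubgroup m) (closureEmb (K := K) (v.adicCompletion K))) ↥(torsionPow M p m))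
        (hℓ : ℓ ∈ goodLevel S κ v M V j ε m m),
        zmodToQmodZ (p ^ m) (localPairingSubgroup K (p ^ m) v ((coeffRepK S θ' P m).restrict (resGalOfEmb (closureEmb (K := K) (v.adicCompletion K))))
          ((torsRep M hstabK p m).restrict (resGalOfEmb (closureEmb (K := K) (v.adicCompletion K))))
          (resPairingAt K (p ^ m) (coeffRepK S θ' P m) (torsRep M hstabK p m) (PG m) v)
          (localSubgroupOfEmb (κ.layerSubgroup m) (closureEmb (K := K) (v.adicCompletion K)))
          (ContinuousCohomology.map (comapSubtypeHom (κ.layerSubgroup m) (resGalOfEmb (closureEmb (K := K) (v.adicCompletion K))))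
            (comapCoeffHom (coeffRepK S θ' P m).toTopRep (κ.layerSubgroup m) (resGalOfEmb (closureEmb (K := K) (v.adicCompletion K)))) 1 y) ℓ) = q ⟨_, hℓ⟩) :
    letI := localAction (closureEmb (K := K) (v.adicCompletion K)) M
    ∃ y ∈ strictLevel S κ θ' P S₀ m m,
      ∀ (ℓ : subgroupH1 (localSubgroupOfEmb (κ.layerSubgroup m) (closureEmb (K := K) (v.adicCompletion K))) ↥(torsionPow M p m))
        (hℓ : ℓ ∈ goodLevel S κ v M V j ε m m),
        locPairNK S κ θ' P v M hstab (fun k ↦ resPairingAt K (p ^ k) (coeffRepK S θ' P k) (torsRep M hstabK p k) (PG k) v) m m y ℓ = q ⟨_, hℓ⟩ := by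
  letI := localAction (closureEmb (K := K) (v.adicCompletion K)) M
  haveI : NeZero (p ^ m) := ⟨pow_ne_zero _ (Fact.out : p.Prime).ne_zero⟩
  haveI : IsClosed (localSubgroupOfEmb (κ.layerSubgroup m) (closureEmb (K := K) (v.adicCompletion K)) : Set (absoluteGaloisGroup (v.adicCompletion K))) :=
    isClosed_localLayer κ v m
  letI : Fintype (absoluteGaloisGroup (v.adicCompletion K) ⧸ localSubgroupOfEmb (κ.layerSubgroup m) (closureEmb (K := K) (v.adicCompletion K))) :=
    fintypeQuotLocalLayer κ v m
  -- H1: descent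
  obtain ⟨yb, rfl⟩ := exists_inflNK_eq_of_resLe_inertia S κ θ' P m m (hNP m) y hyur
  -- H6: strictness
  have hstrict : yb ∈ strictLevel S κ θ' P S₀ m m := mem_strictLevel_of_map_shapiroLift_eq_zero S κ θ' P hNP S₀ m m hs hs1 yb hyS₀
  refine ⟨yb, hstrict, fun ℓ hℓ ↦ ?_⟩
  have h1 := hyval ℓ hℓ
  rw [map_comapSubtypeHom_inflNK] at h1
  rw [locPairNK_apply, pairLoc_apply]
  exact h1

-- One level assembly of H4 with g22's junction currency: the layer group `H¹(U_{m,v}, M[p^m])` appears in two definitionally equal dialects (`subgroupH1` of the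
-- transported action / `subgroupRep (TopRep.res θ (torsRep …).toTopRep)`), whose identification by `rfl` is expensive; hence the raised heartbeat limit.
set_option maxHeartbeats 1600000 in
/-- ★★★ **Finite-level solvability from layer orthogonality.** For a character `q : E^ε_{sat,v} → ℚ/ℤ` of the saturated local condition group and a level `m`:
if `q` kills the class `res_{m→∞}(torsToH1(θ_{U_m,v}^* c))` for every global `c ∈ H¹(U_m, M[p^m])` unramified off `S₀ ∪ {v}` (zero on `U_m ⊓ I_𝔓`) whose layer
localisation lies in `goodLevel m m` (HYPOTHESIS `horth`, brick H5), then some class `y` of the STRICT set `strictLevel S κ θ′ P S₀ m m` has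
`locPairNK … m m y ℓ = q ⟨ℓ⟩` for every `ℓ ∈ goodLevel m m`. Proof: H4 on `Maps(Γ_K ⧸ U_m, X_m)` with `L = goodLevel`, `χ = q/p^m`, then H1 (descent), H6 (strictness)
and R4 (`θ^* ∘ infl = loc`). [cite: MilneADT2006, Ch. I, Thm. 4.10(b)] [cite: NeukirchSchmidtWingberg2008, (8.6.2)–(8.6.3)] [cite: Kobayashi2003, Thm. 7.3 i)] -/
theorem exists_mem_strictLevel_locPairNK_eq_of_orth (V : WeierstrassCurve K) (j : V.geomPrimaryTorsion p →+ M) (S₀ : Set (HeightOneSpectrum (𝓞 K))) (ε : ℤˣ)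
    (PG : ∀ k : ℕ, ContPairing (coeffRepK S θ' P k).toTopRep (torsRep M hstabK p k).toTopRep (mu K (p ^ k)).toTopRep)
    (hS₀ : S₀.Finite) (hvS₀ : v ∉ S₀) (hvP : v ∈ P) (hS₀P : S₀ ⊆ P) (hPS₀ : ∀ w ∈ P, w ∉ S₀ → w = v)
    (hpv : ∀ w : HeightOneSpectrum (𝓞 K), ((p : ℕ) : 𝓞 K) ∈ w.asIdeal → w = v)
    (hNP : ∀ n, ramificationSubgroup K P ≤ κ.layerSubgroup n) (hv : AcSigned.IsNonsplitIn κ v)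
    (hstab : letI := localAction (closureEmb (K := K) (v.adicCompletion K)) M
      ∀ m : M, IsOpen (MulAction.stabilizer (absoluteGaloisGroup (v.adicCompletion K)) m : Set (absoluteGaloisGroup (v.adicCompletion K))))
    (q : letI := localAction (closureEmb (K := K) (v.adicCompletion K)) M
      localCondInftySat κ M (padicCoeffIntegers S) V j ε v →+ AddCircle (1 : ℚ))
    (m : ℕ) (hperf : Bijective fun a : ↥(torsionPow M p m) ↦ (PG m).toLin.flip a)
    (horth : letI := localAction (closureEmb (K := K) (v.adicCompletion K)) M
      ∀ c : subgroupH1 (κ.layerSubgroup m) ↥(torsionPow M p m),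
        (∀ w : HeightOneSpectrum (𝓞 K), w ≠ v → w ∉ S₀ → ∀ 𝔓 ∈ w.primesAbove,
          resLe (torsRep M hstabK p m).toTopRep (inf_le_left : κ.layerSubgroup m ⊓ 𝔓.inertia (absoluteGaloisGroup K) ≤ κ.layerSubgroup m) 1 c = 0) →
        ∀ hc : ContinuousCohomology.map (comapSubtypeHom (κ.layerSubgroup m) (resGalOfEmb (closureEmb (K := K) (v.adicCompletion K))))
            (comapCoeffHom (torsRep M hstabK p m).toTopRep (κ.layerSubgroup m) (resGalOfEmb (closureEmb (K := K) (v.adicCompletion K)))) 1 c ∈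
            goodLevel S κ v M V j ε m m,
          q ⟨_, hc⟩ = 0) :
    letI := localAction (closureEmb (K := K) (v.adicCompletion K)) M
    ∃ y ∈ strictLevel S κ θ' P S₀ m m,
      ∀ (ℓ : subgroupH1 (localSubgroupOfEmb (κ.layerSubgroup m) (closureEmb (K := K) (v.adicCompletion K))) ↥(torsionPow M p m))
        (hℓ : ℓ ∈ goodLevel S κ v M V j ε m m),
        locPairNK S κ θ' P v M hstab (fun k ↦ resPairingAt K (p ^ k) (coeffRepK S θ' P k) (torsRep M hstabK p k) (PG k) v) m m y ℓ = q ⟨_, hℓ⟩ := by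
  letI := localAction (closureEmb (K := K) (v.adicCompletion K)) M
  haveI : CompactSpace (absoluteGaloisGroup K) := absoluteGaloisGroup_compactSpace _
  haveI : CompactSpace (absoluteGaloisGroup (v.adicCompletion K)) := absoluteGaloisGroup_compactSpace _
  haveI : NeZero (p ^ m) := ⟨pow_ne_zero _ (Fact.out : p.Prime).ne_zero⟩
  haveI hFin : ∀ n : ℕ, Finite (absoluteGaloisGroup K ⧸ κ.layerSubgroup n) := fun n ↦ by
    haveI : DiscreteTopology (absoluteGaloisGroup K ⧸ κ.layerSubgroup n) := QuotientGroup.discreteTopology (κ.isOpen_layerSubgroup n)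
    exact finite_of_compact_of_discrete
  letI hF : ∀ n : ℕ, Fintype (absoluteGaloisGroup K ⧸ κ.layerSubgroup n) := fun n ↦ Fintype.ofFinite _
  haveI hFI : ∀ n : ℕ, (κ.layerSubgroup n).FiniteIndex := fun n ↦ ⟨by rw [κ.index_layerSubgroup]; exact pow_ne_zero _ (Fact.out : p.Prime).ne_zero⟩
  letI hR : ∀ n : ℕ, Fintype (↥(κ.layerSubgroup n) ⧸ (κ.layerSubgroup (n + 1)).subgroupOf (κ.layerSubgroup n)) := fun n ↦
    @Fintype.ofFinite _ (Subgroup.finite_quotient_of_finiteIndex)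
  haveI : IsClosed (localSubgroupOfEmb (κ.layerSubgroup m) (closureEmb (K := K) (v.adicCompletion K)) : Set (absoluteGaloisGroup (v.adicCompletion K))) :=
    isClosed_localLayer κ v m
  letI : Fintype (absoluteGaloisGroup (v.adicCompletion K) ⧸ localSubgroupOfEmb (κ.layerSubgroup m) (closureEmb (K := K) (v.adicCompletion K))) :=
    fintypeQuotLocalLayer κ v m
  haveI := finite_oMuCarrier (K := K) S m
  -- sections of `Γ_K ⧸ U_m` and `Γ_{K_v} ⧸ U_{m,v}`
  obtain ⟨s, hs, hs1⟩ := exists_reps_one (G := absoluteGaloisGroup K) (κ.layerSubgroup m)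
  obtain ⟨sD, hsD, hsD1⟩ := exists_reps_one (G := absoluteGaloisGroup (v.adicCompletion K))
    (localSubgroupOfEmb (κ.layerSubgroup m) (closureEmb (K := K) (v.adicCompletion K)))
  -- the bi-additive form of the level-`m` pairing and its perfectness
  set B : ↥(Representation.invariants ((muTwistO S θ' m).toRepresentation.comp (ramificationSubgroup K P).subtype)) →+
      ↥(torsionPow M p m) →+ MuCarrier K (p ^ m) := LinearMap.toAddMonoidHom'.comp (PG m).toLin.toAddMonoidHom with hBdef
  have hBapp : ∀ x a, B x a = (PG m).toLin x a := fun _ _ ↦ rfl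
  have hB : ∀ (σ : absoluteGaloisGroup K) (x : ↥(Representation.invariants ((muTwistO S θ' m).toRepresentation.comp (ramificationSubgroup K P).subtype)))
      (a : ↥(torsionPow M p m)), B (coeffRepK S θ' P m σ x) (torsRep M hstabK p m σ a) = mu K (p ^ m) σ (B x a) :=
    fun σ x a ↦ (PG m).toLin_smul σ x a
  have hPG : pairing (coeffRepK S θ' P m) (torsRep M hstabK p m) (mu K (p ^ m)) B hB = PG m :=
    contPairing_eq_of_toLin_eq (LinearMap.ext fun _ ↦ LinearMap.ext fun _ ↦ rfl)
  have hBbij : Bijective fun a : ↥(torsionPow M p m) ↦ B.flip a := by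
    constructor
    · intro a a' h
      apply hperf.1
      exact LinearMap.ext fun x ↦ (DFunLike.congr_fun h x :)
    · intro f
      obtain ⟨a, ha⟩ := hperf.2 f.toIntLinearMap
      exact ⟨a, AddMonoidHom.ext fun x ↦ (LinearMap.congr_fun ha x :)⟩
  -- `X_m` is killed by `p^m`; the places dividing `p^m` lie under `v`; `Maps(Γ_K ⧸ U_m, X_m)` is unramified off `S₀ ∪ {v}`
  have hMn : ∀ x : ↥(Representation.invariants ((muTwistO S θ' m).toRepresentation.comp (ramificationSubgroup K P).subtype)), (p ^ m) • x = 0 :=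
    fun x ↦ by rw [← natCast_zsmul]; exact_mod_cast coeffGSO_torsion S P θ' m x
  have hn : ∀ w : HeightOneSpectrum (𝓞 K), ((p ^ m : ℕ) : 𝓞 K) ∈ w.asIdeal → w ∈ insert v hS₀.toFinset := fun w hw ↦ by
    rw [Nat.cast_pow] at hw
    rw [hpv w (w.isPrime.mem_of_pow_mem m hw)]
    exact Finset.mem_insert_self _ _
  have hur : ∀ w : HeightOneSpectrum (𝓞 K), w ∉ insert v hS₀.toFinset →
      GaloisRep.IsUnramifiedAt w (DiscreteGaloisModule.coind (coeffRepK S θ' P m) (κ.layerSubgroup m) (κ.isOpen_layerSubgroup m)) := by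
    intro w hw
    have hwv : w ≠ v := fun h ↦ hw (h ▸ Finset.mem_insert_self _ _)
    have hwS : w ∉ S₀ := fun h ↦ hw (Finset.mem_insert_of_mem (hS₀.mem_toFinset.mpr h))
    have hwP : w ∉ P := fun h ↦ hwv (hPS₀ w h hwS)
    exact SignedLowerOffTwo.PTDeep.isUnramifiedAt_coind _ _ _ (isUnramifiedAt_coeffRepK S θ' P m hwP)
      fun 𝔓 h𝔓 ↦ (inertia_le_ramificationSubgroup hwP h𝔓).trans (hNP m)
  -- ### the good set as a subgroup of `H¹(U_{m,v}, M[p^m])` and the character `χ = q / p^m` on it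
  let incl : subgroupH1 (localSubgroupOfEmb (κ.layerSubgroup m) (closureEmb (K := K) (v.adicCompletion K))) ↥(torsionPow M p m) →+
      subgroupH1 (localSubgroupOfEmb κ.kerSubgroup (closureEmb (K := K) (v.adicCompletion K))) M :=
    (resOfLe M (localSubgroupOfEmb_kerSubgroup_le κ v m)).comp
      (torsToH1 M p (localSubgroupOfEmb (κ.layerSubgroup m) (closureEmb (K := K) (v.adicCompletion K))) m)
  -- the good set, as a subgroup WITHOUT a body and typed in H4's dialect (keeps the two `H¹(U_{m,v}, M[p^m])` dialects from being unfolded against each other)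
  obtain ⟨L, hLmem⟩ : ∃ L : AddSubgroup (continuousCohomology 1 (subgroupRep (TopRep.res (resGalOfEmb (closureEmb (K := K) (v.adicCompletion K)) : absoluteGaloisGroup (v.adicCompletion K) →* absoluteGaloisGroup K) (torsRep M hstabK p m).toTopRep)
      ((κ.layerSubgroup m).comap (resGalOfEmb (closureEmb (K := K) (v.adicCompletion K)) : absoluteGaloisGroup (v.adicCompletion K) →* absoluteGaloisGroup K)))),
      ∀ ℓ, ℓ ∈ L ↔ incl ℓ ∈ localCondInftySat κ M (padicCoeffIntegers S) V j ε v :=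
    ⟨(localCondInftySat κ M (padicCoeffIntegers S) V j ε v).comap incl, fun _ ↦ Iff.rfl⟩
  let inclL : L →+ localCondInftySat κ M (padicCoeffIntegers S) V j ε v := (incl.comp L.subtype).codRestrict _ fun ℓ ↦ (hLmem ℓ).mp ℓ.2
  -- `L` is killed by `p^m`
  haveI : CompactSpace ↥(localSubgroupOfEmb (κ.layerSubgroup m) (closureEmb (K := K) (v.adicCompletion K))) :=
    isCompact_iff_compactSpace.mp (isClosed_localLayer κ v m).isCompact
  have hH1tors : ∀ a : subgroupH1 (localSubgroupOfEmb (κ.layerSubgroup m) (closureEmb (K := K) (v.adicCompletion K))) ↥(torsionPow M p m),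
      (p ^ m) • a = 0 := by
    intro a
    obtain ⟨φ, rfl⟩ := oneCocycleClass_surjective
      (discreteTopRep ↥(localSubgroupOfEmb (κ.layerSubgroup m) (closureEmb (K := K) (v.adicCompletion K))) ↥(torsionPow M p m)) a
    have hφ : ((p ^ m : ℕ) : ℤ) • φ = 0 := by
      refine Subtype.ext (ContinuousMap.ext fun g ↦ ?_)
      change ((p ^ m : ℕ) : ℤ) • φ.1 g = 0
      rw [natCast_zsmul]
      exact Subtype.ext (by rw [AddSubmonoidClass.coe_nsmul]; exact (mem_torsionPow_iff (M := M) (p := p) m _).mp (φ.1 g).2)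
    change (p ^ m) • oneCocycleClass _ φ = (0 : ↥(continuousCohomology 1 _))
    rw [← Nat.cast_smul_eq_nsmul ℤ, ← oneCocycleClass_smul, hφ, oneCocycleClass_zero]
  have hLtors : ∀ a : L, (p ^ m) • a = 0 := fun a ↦ Subtype.ext (by rw [AddSubmonoidClass.coe_nsmul]; exact hH1tors a.1)
  obtain ⟨χ, hχE⟩ := PoitouTateFinite.PoitouTateShaTwoReadout.exists_addMonoidHom_zmodToQmodZ_eq hLtors (q.comp inclL)
  -- ### H4's orthogonality hypothesis from `horth`
  have hχ : ∀ c : continuousCohomology 1 (subgroupRep (torsRep M hstabK p m).toTopRep (κ.layerSubgroup m)),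
      (∀ w : HeightOneSpectrum (𝓞 K), w ∉ insert v hS₀.toFinset → ∀ 𝔓 ∈ w.primesAbove,
        resLe (torsRep M hstabK p m).toTopRep (inf_le_left : κ.layerSubgroup m ⊓ 𝔓.inertia (absoluteGaloisGroup K) ≤ κ.layerSubgroup m) 1 c = 0) →
      ∀ hc : ContinuousCohomology.map (comapSubtypeHom (κ.layerSubgroup m) (resGalOfEmb (closureEmb (K := K) (v.adicCompletion K))))
          (comapCoeffHom (torsRep M hstabK p m).toTopRep (κ.layerSubgroup m) (resGalOfEmb (closureEmb (K := K) (v.adicCompletion K)))) 1 c ∈ L,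
        χ ⟨_, hc⟩ = 0 := by
    intro c hcur hc
    apply zmodToQmodZ_injective (p ^ m)
    rw [hχE, map_zero]
    exact horth c (fun w hwv hwS ↦ hcur w fun h ↦ by
      rcases Finset.mem_insert.mp h with h | h
      · exact hwv h
      · exact hwS (hS₀.mem_toFinset.mp h)) ((mem_goodLevel_iff S κ v M V j ε m m _).mpr ((hLmem _).mp hc))
  -- ### H4: Poitou–Tate solvability at the layer `K̄^{U_m}`
  obtain ⟨y, hyS₀, hyur, hyval⟩ := exists_layer_localPairingSubgroup_eq K (p ^ m) (coeffRepK S θ' P m) (torsRep M hstabK p m) B hB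
    (κ.layerSubgroup m) (κ.isOpen_layerSubgroup m) v hBbij hMn hsD hsD1 (quotientMapOfHom_surjective_of_isNonsplitIn κ v hv m) hs hs1
    hS₀.toFinset hn hur L χ hχ
  -- ### H1 + H6 + readout (separate declaration: keeps the elaboration of the two dialects apart)
  refine exists_mem_strictLevel_locPairNK_eq_of_layer_class S κ θ' P v M hstabK V j S₀ ε PG hNP hstab q m hs hs1 y
    (fun w hw ↦ hyS₀ w (hS₀.mem_toFinset.mpr hw) fun h ↦ hvS₀ (h ▸ hw))
    (fun w hwP 𝔓 h𝔓 ↦ hyur w (fun h ↦ by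
      rcases Finset.mem_insert.mp h with h | h
      · exact hwP (h ▸ hvP)
      · exact hwP (hS₀P (hS₀.mem_toFinset.mp h))) 𝔓 h𝔓)
    fun ℓ hℓ ↦ ?_
  have hℓL : ℓ ∈ L := (hLmem ℓ).mpr ((mem_goodLevel_iff S κ v M V j ε m m ℓ).mp hℓ)
  have h1 := hyval ℓ hℓL
  rw [hPG] at h1
  exact (congrArg (zmodToQmodZ (p ^ m)) h1).trans (hχE ⟨ℓ, hℓL⟩)

end Solve

end Summit.BirchSwinnertonDyer.BirchSwinnertonDyer.Theorems.SmallImageRttD2Seq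

end
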